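import Summits.AtomisticToContinuum.FouriersLaw.Theorems.BondHeatUncertaintyExtensiveSnapshotIrreversibilityEnergyWindowSkeletonFieldCalculusA

/-!
# Energy window, part W-1 — pointwise calculus of the skeleton control fields: implicit — file 2 of 2 (sequel of `…BondHeatUncertaintyExtensiveSnapshotIrreversibilityEnergyWindowSkeletonFieldCalculusA`)

Split for the 400-line cap; the module docstring of file 1 describes the whole part.
This file holds §4 (the size of `∂_v u_j`) and the arrival-field bounds.
Same namespace, same section variables; no instance / notation / option; no proof holes.
[folklore]
-/

noncomputable section

namespace Summit.AtomisticToContinuum.FouriersLaw.Theorems.ExtensiveSnapshotIrreversibility.EnergyWindow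

open MeasureTheory ProbabilityTheory Filter Topology Set
open scoped ENNReal NNReal Matrix ContDiff
open Literature.MathematicalPhysics.KineticTheory.HeatConduction
open Literature.Probability.Process

section Pointwise

variable {ω₂ lam β γ : ℝ} (hω : 0 < ω₂) (hl : 0 ≤ lam) (hβ : 0 ≤ β) (hγ : 0 ≤ γ) (N : ℕ)
  (T_L T_R : ℝ)

include hω hl hβ hγ

/-! ## 4. The size of `∂_v u_j` -/

/-- **The derivative of the field**: `∂_v u_j = Σ_i (c_i ∂_vJ_ij + J_ij ∂_v c_i)`. [folklore] -/
theorem fderiv_skelFieldGen_apply {s : ℝ} (hs : s ∈ Icc (0 : ℝ) 1) (m : ℕ) {κ : ℝ} (hκ : 0 < κ)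
    (z : PhaseSpace N) (r : WienerPair) {e : PairSkeleton m → Fin N ⊕ Fin N → ℝ}
    (he : ∀ a, Differentiable ℝ fun y => e y a) (x v : PairSkeleton m)
    (j : Fin (2 ^ m) ⊕ Fin (2 ^ m)) :
    fderiv ℝ (fun y => skelFieldGen ω₂ lam β γ N T_L T_R s m κ z r e y j) x v =
      ∑ i, (skelCtrlGen ω₂ lam β γ N T_L T_R s m κ z r e x i *
          fderiv ℝ (fun y => skelJacAt ω₂ lam β γ N T_L T_R s m z r y i j) x v +
        skelJacAt ω₂ lam β γ N T_L T_R s m z r x i j *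
          fderiv ℝ (fun y => skelCtrlGen ω₂ lam β γ N T_L T_R s m κ z r e y i) x v) := by
  have hR : ∀ k l, Differentiable ℝ fun y =>
      regInv (skelGramAt ω₂ lam β γ N T_L T_R s m z r y) κ k l := fun k l =>
    (contDiff_regInv_skelGramAt_apply hω hl hβ hγ N T_L T_R hs m hκ z r k l).differentiable
      (by simp)
  have hcd : ∀ i, Differentiable ℝ fun y => skelCtrlGen ω₂ lam β γ N T_L T_R s m κ z r e y i :=
    fun i => by
    have h : (fun y => skelCtrlGen ω₂ lam β γ N T_L T_R s m κ z r e y i) = fun y =>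
        ∑ l, regInv (skelGramAt ω₂ lam β γ N T_L T_R s m z r y) κ i l * e y l := by
      funext y; simp only [skelCtrlGen, Matrix.mulVec, dotProduct]
    rw [h]
    exact Differentiable.fun_sum fun l _ => (hR i l).fun_mul (he l)
  have hJ : ∀ i, HasFDerivAt (fun y => skelJacAt ω₂ lam β γ N T_L T_R s m z r y i j)
      (fderiv ℝ (fun y => skelJacAt ω₂ lam β γ N T_L T_R s m z r y i j) x) x := fun i =>
    ((contDiff_skelJacAt_apply hω hl hβ hγ N T_L T_R hs m z r i j).differentiable
      (by simp) x).hasFDerivAt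
  have hsum :=
    HasFDerivAt.fun_sum (u := Finset.univ) fun i _ => ((hcd i x).hasFDerivAt).fun_mul (hJ i)
  have hfun : (fun y => skelFieldGen ω₂ lam β γ N T_L T_R s m κ z r e y j) = fun y =>
      ∑ i, skelCtrlGen ω₂ lam β γ N T_L T_R s m κ z r e y i *
        skelJacAt ω₂ lam β γ N T_L T_R s m z r y i j := by
    funext y; simp only [skelFieldGen, Matrix.vecMul, dotProduct]
  rw [hfun, hsum.fderiv]
  simp only [_root_.sum_apply, _root_.add_apply, _root_.smul_apply, smul_eq_mul]

/-- ★ **Size of `∂_v u_j`** in terms of first / second skeleton variations of the flow and of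
`e`, `∂_v e`: with `F_l = ‖DE(x) b_l‖`, `S_l = ‖∂_v DE(x) b_l‖`, `|e|₁ = Σ_a|e_a(x)|`,
`|∂e|₁ = Σ_a |∂_v e_a(x)|`, `K = 2N`:
`|∂_v u_j| ≤ K (κ⁻¹|e|₁ S_j + F_j κ⁻¹ (|∂e|₁ + κ⁻¹|e|₁ K² · 2 · 2^{-m} Σ_l F_l S_l))`. [folklore] -/
theorem abs_fderiv_skelFieldGen_le {s : ℝ} (hs : s ∈ Icc (0 : ℝ) 1) (m : ℕ) {κ : ℝ} (hκ : 0 < κ)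
    (z : PhaseSpace N) (r : WienerPair) {e : PairSkeleton m → Fin N ⊕ Fin N → ℝ}
    (he : ∀ a, Differentiable ℝ fun y => e y a) (x v : PairSkeleton m)
    (j : Fin (2 ^ m) ⊕ Fin (2 ^ m)) :
    |fderiv ℝ (fun y => skelFieldGen ω₂ lam β γ N T_L T_R s m κ z r e y j) x v| ≤
      (Fintype.card (Fin N ⊕ Fin N) : ℝ) *
        ((κ⁻¹ * ∑ a, |e x a|) *
            ‖fderiv ℝ (fun y => fderiv ℝ (skelFlowMapAt ω₂ lam β γ N T_L T_R s m z r) y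
              (basisX m j)) x v‖ +
          ‖fderiv ℝ (skelFlowMapAt ω₂ lam β γ N T_L T_R s m z r) x (basisX m j)‖ *
            (κ⁻¹ * (∑ k, |fderiv ℝ (fun y => e y k) x v| + (κ⁻¹ * ∑ a, |e x a|) *
              ((Fintype.card (Fin N ⊕ Fin N) : ℝ) ^ 2 * (2 * (((2 : ℝ) ^ m)⁻¹ *
                ∑ l, ‖fderiv ℝ (skelFlowMapAt ω₂ lam β γ N T_L T_R s m z r) x (basisX m l)‖ *
                  ‖fderiv ℝ (fun y => fderiv ℝ (skelFlowMapAt ω₂ lam β γ N T_L T_R s m z r) y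
                    (basisX m l)) x v‖)))))) := by
  rw [fderiv_skelFieldGen_apply hω hl hβ hγ N T_L T_R hs m hκ z r he x v j]
  refine (Finset.abs_sum_le_sum_abs _ _).trans ?_
  have hK : ∀ (c : ℝ), ∑ _i : Fin N ⊕ Fin N, c = (Fintype.card (Fin N ⊕ Fin N) : ℝ) * c :=
    fun c => by rw [Finset.sum_const, Finset.card_univ, nsmul_eq_mul]
  refine (Finset.sum_le_sum fun i _ => ?_).trans (le_of_eq (hK _))
  refine (abs_add_le _ _).trans ?_
  rw [abs_mul, abs_mul]
  refine add_le_add ?_ ?_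
  · exact mul_le_mul (abs_skelCtrlGen_le N T_L T_R s m hκ z r e x i)
      (abs_fderiv_skelJacAt_apply_le hω hl hβ hγ N T_L T_R hs m z r x i j v) (abs_nonneg _)
      (by positivity)
  · refine mul_le_mul (abs_skelJacAt_le N T_L T_R s m z r x i j)
      ((abs_fderiv_skelCtrlGen_le hω hl hβ hγ N T_L T_R hs m hκ z r he x v i).trans ?_)
      (abs_nonneg _) (norm_nonneg _)
    -- `Σ_k Σ_i' |∂Γ_ki'| ≤ K² · 2Θ`
    have hΓsum : ∑ k, ∑ i', |fderiv ℝ (fun y => skelGramAt ω₂ lam β γ N T_L T_R s m z r y k i') x v|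
        ≤ (Fintype.card (Fin N ⊕ Fin N) : ℝ) ^ 2 * (2 * (((2 : ℝ) ^ m)⁻¹ *
          ∑ l, ‖fderiv ℝ (skelFlowMapAt ω₂ lam β γ N T_L T_R s m z r) x (basisX m l)‖ *
            ‖fderiv ℝ (fun y => fderiv ℝ (skelFlowMapAt ω₂ lam β γ N T_L T_R s m z r) y
              (basisX m l)) x v‖)) := by
      refine (Finset.sum_le_sum fun k _ => Finset.sum_le_sum fun i' _ =>
        abs_fderiv_skelGramAt_apply_le hω hl hβ hγ N T_L T_R hs m z r x k i' v).trans (le_of_eq ?_)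
      rw [hK, hK, sq, mul_assoc]
    have hB : 0 ≤ κ⁻¹ * ∑ a, |e x a| :=
      mul_nonneg (inv_nonneg.2 hκ.le) (Finset.sum_nonneg fun a _ => abs_nonneg _)
    exact mul_le_mul_of_nonneg_left (add_le_add le_rfl (mul_le_mul_of_nonneg_left hΓsum hB))
      (inv_nonneg.2 hκ.le)

/-! ## 4. The arrival field (`e ≡ e_b` constant): clean bounds -/

omit hω hl hβ hγ in
/-- **Arrival field size**: `|u_j(x)| ≤ 2N κ⁻¹ ‖DE(x) b_j‖`. [folklore] -/
theorem abs_skelFieldArr_le (s : ℝ) (m : ℕ) {κ : ℝ} (hκ : 0 < κ) (b : Fin N) (z : PhaseSpace N)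
    (r : WienerPair) (x : PairSkeleton m) (j : Fin (2 ^ m) ⊕ Fin (2 ^ m)) :
    |skelFieldArr ω₂ lam β γ N T_L T_R s m κ b z r x j| ≤
      (Fintype.card (Fin N ⊕ Fin N) : ℝ) * κ⁻¹ *
        ‖fderiv ℝ (skelFlowMapAt ω₂ lam β γ N T_L T_R s m z r) x (basisX m j)‖ := by
  rw [skelFieldArr_eq_skelFieldGen]
  have h := abs_skelFieldGen_le (ω₂ := ω₂) (lam := lam) (β := β) (γ := γ) N T_L T_R s m hκ z r
    (fun _ => momCoord N b) x j
  rw [sum_abs_momCoord, mul_one] at h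
  exact h

/-- **Arrival field derivative**: `|∂_v u_j(x)| ≤ 2N (κ⁻¹ S_{j,v} + κ⁻² (2N)² 2 · 2^{-m}
Σ_l F_j F_l S_{l,v})` with `F_l = ‖DE b_l‖`, `S_{l,v} = ‖∂_v DE b_l‖`. [folklore] -/
theorem abs_fderiv_skelFieldArr_le {s : ℝ} (hs : s ∈ Icc (0 : ℝ) 1) (m : ℕ) {κ : ℝ} (hκ : 0 < κ)
    (b : Fin N) (z : PhaseSpace N) (r : WienerPair) (x v : PairSkeleton m)
    (j : Fin (2 ^ m) ⊕ Fin (2 ^ m)) :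
    |fderiv ℝ (fun y => skelFieldArr ω₂ lam β γ N T_L T_R s m κ b z r y j) x v| ≤
      (Fintype.card (Fin N ⊕ Fin N) : ℝ) *
        (κ⁻¹ * ‖fderiv ℝ (fun y => fderiv ℝ (skelFlowMapAt ω₂ lam β γ N T_L T_R s m z r) y
              (basisX m j)) x v‖ +
          ‖fderiv ℝ (skelFlowMapAt ω₂ lam β γ N T_L T_R s m z r) x (basisX m j)‖ *
            (κ⁻¹ * (κ⁻¹ * ((Fintype.card (Fin N ⊕ Fin N) : ℝ) ^ 2 * (2 * (((2 : ℝ) ^ m)⁻¹ *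
                ∑ l, ‖fderiv ℝ (skelFlowMapAt ω₂ lam β γ N T_L T_R s m z r) x (basisX m l)‖ *
                  ‖fderiv ℝ (fun y => fderiv ℝ (skelFlowMapAt ω₂ lam β γ N T_L T_R s m z r) y
                    (basisX m l)) x v‖)))))) := by
  have hfun : (fun y => skelFieldArr ω₂ lam β γ N T_L T_R s m κ b z r y j) = fun y =>
      skelFieldGen ω₂ lam β γ N T_L T_R s m κ z r (fun _ => momCoord N b) y j := by
    funext y; rw [skelFieldArr_eq_skelFieldGen]
  have he : ∀ a, Differentiable ℝ fun _ : PairSkeleton m => momCoord N b a :=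
    fun a => differentiable_const _
  have h := abs_fderiv_skelFieldGen_le hω hl hβ hγ N T_L T_R hs m hκ z r he x v j
  have h0 : ∑ k, |fderiv ℝ (fun _ : PairSkeleton m => momCoord N b k) x v| = 0 :=
    Finset.sum_eq_zero fun k _ => by rw [fderiv_fun_const]; simp
  rw [h0, sum_abs_momCoord, zero_add, mul_one] at h
  rw [hfun]
  exact h

end Pointwise

end Summit.AtomisticToContinuum.FouriersLaw.Theorems.ExtensiveSnapshotIrreversibility.EnergyWindow

end
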